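import Mathlib
import HarnessLib
import Summits.HubbardSuperconductivity.HubbardSuperconductivity.Theorems.KLProgrammeKLRegimeTwoLegCurvatureDefs
import Summits.HubbardSuperconductivity.HubbardSuperconductivity.Theorems.KLProgrammeKLRegimeSplitTwoLegIncrementSizes
import Summits.HubbardSuperconductivity.HubbardSuperconductivity.Theorems.KLProgrammeKLRegimeSplitTwoLegSizesMSQ

/-!
# K3 ENGINE child (stmt-HubbardSuperconductivity-20236 `KLRegimeEngineV16`), two-leg stubs (M)/(e): the (E3a-MS-TQ) conjunct
# `TwoLegSizesMSTQ … K n` FROM THE CURVE-JET PREDICATE of stub 6 — the trivial split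

Cell gate-hubbard-kl, seat hubbard-kl-k3c3-p3 (g5; row «implicit-function / monotonicity route for μ(n)», MS lane).  Plan g15 l.2370 (2)/(9):
«the slot bars … for `lp n` of `TwoLegSizesMSFnQ` (j ≤ 4) are met as soon as the ANGULAR JETS of δ_n obey … bounds — the extension contributes NO
n-dependence … (MS: same reduction for `lp n`)».  This file types that reduction against p2's stub-6 predicate of record
`TwoLegCurveJetBound L M c c' β U μ K n` (…TwoLegCurvatureDefs): the curve profile `δ_n` is `C⁴` with `|δ_n^{(k)}(θ)| ≤ curveJetBar c c' U k n`, `k ≤ 4`.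

* §1 `curveExtC X c j` — the CLOSED-FORM constants of the extension at order `j` (linear in `c`): `(1+4X)·c 0` at `j = 0`,
  `(j!)²·(2·j!·X·200ʲ)·(4 + max 1 ((j−1)!/(8/5)))ʲ·(2π·c 1 + Σ_{1≤i≤j} c i)` at `j ≥ 1`;
* §2 **`norm_iteratedFDeriv_onM_klFrameExtFn_le_curveJetBar`** — GENERIC: a `2π`-periodic `C⁴` profile `δ` with jets within `curveJetBar c c' U k n`
  (`k ≤ 4`) has G-extension `klFrameExtFn μ δ` with `‖Dʲ onM (klFrameExtFn μ δ) q‖ ≤ curveJetBar (curveExtC X c) (curveExtC X c') U j n` (`j ≤ 4`,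
  every `q`; `X ≥ sup_{l ≤ 4} ‖Dˡχ₂‖`, `μ ∈ klWindowC`) — `norm_iteratedFDeriv_onM_piece_le` (n-free chain rule) with the centred envelope taken from
  the SLOPE (`abs_sub_klAngularMean_le_of_deriv`: `|δ − mean δ| ≤ 2π·sup|δ′|`), so that the `j ≥ 1` envelope is `U²`-sized, not `|U|`-sized;
* §3 **`norm_iteratedFDeriv_onM_klTwoLegPieceFn_eval_le_of_curveJetBound`** — the sizes of `ℓ_n(K.eval)` at every order `j ≤ 4` from
  `TwoLegCurveJetBound … K n` (both `n = 0` and `n + 1`; continuity of the local parts / of `K∘k_F^K` as hypotheses, as in …TwoLegPieceFnEval);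
* §4 **`twoLegSizesMSWith_of_curveJetBound`** — the budget-parametric MS text with the TRIVIAL split `lp n := ℓ_n(K.eval)`, `lp m := 0` (`m ≠ n`):
  `TwoLegSizesMSWith L M β U μ K.eval n (fun j => curveJetBar (curveExtC X c) (curveExtC X c') U j n) (fun _ _ => 0)`;
  **`twoLegSizesMSTQ_of_curveJetBound`** — the V15/V16 slot text `TwoLegSizesMSTQ L M G Q R β U μ K n` under the TEN package inequalities
  `curveExtC X c j ≤ G.S j`, `curveExtC X c' j ≤ Q.S' j` (`j ≤ 4`) and the signs of `Q.CE`, `G.S 1`, `Q.S' 1`, `R.Gfr`.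

Consequence for the engine's residual table (r2d-p1 RESIDUAL-TABLE-e-succ rows B2–B7): under the v4 hypothesis (stub 6) the MS conjunct needs NO symbol
decomposition `hS`, no profiles `σ/ε`, no `Λ₃/Λ₄`, no MS fits — only continuity (row §4 of the door), `X`, and the package fit.  The σ/ε chain
(…TwoLegSizesMSLowMixed) stays the consumer of record WITHOUT stub 6.  Proofs only; nothing about the model is asserted.
References: BGM 2006 §2.4 (2.36)–(2.42) [cite: BenfattoGiulianiMastropietro2006].
-/

noncomputable section

namespace Summit.HubbardSuperconductivity.HubbardSuperconductivity.Theorems.KLRegimeSplit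

set_option linter.dupNamespace false -- summit = problem name (single-conjunct summit), D-0017

open Real Finset MeasureTheory Literature.MathematicalPhysics.QuantumLattice Literature.MathematicalPhysics.QuantumLattice.FermiRG
open Literature.Probability.LatticeModels
open Summit.HubbardSuperconductivity.HubbardSuperconductivity.Theorems.PerturbedFermiCurve

/-! ## §1 The closed-form extension constants -/

/-- **Extension constants** `curveExtC X c j`: at `j = 0` `(1 + 4X)·c 0`; at `j ≥ 1`
`(j!)²·(2·j!·X·200ʲ)·(4 + max 1 ((j−1)!/(8/5)))ʲ·(2π·c 1 + Σ_{i ∈ Icc 1 j} c i)` — linear in `c`. -/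
def curveExtC (X : ℝ) (c : ℕ → ℝ) (j : ℕ) : ℝ :=
  if j = 0 then (1 + 4 * X) * c 0
  else (j.factorial : ℝ) ^ 2 * (2 * j.factorial * X * 200 ^ j) * (4 + max 1 (((j - 1).factorial : ℝ) / (8 / 5))) ^ j *
    (2 * π * c 1 + ∑ i ∈ Icc 1 j, c i)

/-- `curveExtC` at order `0`. -/
theorem curveExtC_zero (X : ℝ) (c : ℕ → ℝ) : curveExtC X c 0 = (1 + 4 * X) * c 0 := by simp [curveExtC]

/-- `curveExtC` at order `j ≥ 1`. -/
theorem curveExtC_of_ne_zero (X : ℝ) (c : ℕ → ℝ) {j : ℕ} (hj : j ≠ 0) :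
    curveExtC X c j = (j.factorial : ℝ) ^ 2 * (2 * j.factorial * X * 200 ^ j) * (4 + max 1 (((j - 1).factorial : ℝ) / (8 / 5))) ^ j *
      (2 * π * c 1 + ∑ i ∈ Icc 1 j, c i) := by
  simp [curveExtC, hj]

/-- `curveExtC` is nonnegative for `X ≥ 0` and nonnegative constants. -/
theorem curveExtC_nonneg {X : ℝ} (hX : 0 ≤ X) {c : ℕ → ℝ} (hc : ∀ k, 0 ≤ c k) (j : ℕ) : 0 ≤ curveExtC X c j := by
  unfold curveExtC
  split_ifs
  · have := hc 0; positivity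
  · have h1 : 0 ≤ 2 * π * c 1 + ∑ i ∈ Icc 1 j, c i := add_nonneg (by have := hc 1; positivity) (sum_nonneg fun i _ => hc i)
    positivity

/-- `curveExtC` is monotone in the constants. -/
theorem curveExtC_mono {X : ℝ} (hX : 0 ≤ X) {c d : ℕ → ℝ} (hcd : ∀ k, c k ≤ d k) (j : ℕ) : curveExtC X c j ≤ curveExtC X d j := by
  unfold curveExtC
  split_ifs
  · exact mul_le_mul_of_nonneg_left (hcd 0) (by positivity)
  · refine mul_le_mul_of_nonneg_left ?_ (by positivity)
    exact add_le_add (mul_le_mul_of_nonneg_left (hcd 1) (by positivity)) (sum_le_sum fun i _ => hcd i)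

/-- `curveExtC` is linear in the constants (scalar multiples). -/
theorem curveExtC_smul (X e : ℝ) (c : ℕ → ℝ) (j : ℕ) : curveExtC X (fun k => e * c k) j = e * curveExtC X c j := by
  unfold curveExtC
  split_ifs
  · ring
  · rw [← mul_sum]; ring

/-- `curveExtC` of the zero family vanishes. -/
theorem curveExtC_zero_fun (X : ℝ) (j : ℕ) : curveExtC X (fun _ => 0) j = 0 := by
  have h := curveExtC_smul X 0 (fun _ => (0 : ℝ)) j
  simpa using h

/-! ## §2 Generic: sizes of a G-extension from curve jets of the profile -/

section Generic

variable {δ : ℝ → ℝ} {c c' : ℕ → ℝ} {U : ℝ} {n : ℕ}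

/-- The `4^{(k−2)n}` factor is monotone in the order `k`. -/
theorem four_zpow_order_mono {i j : ℕ} (hij : i ≤ j) (n : ℕ) :
    (4 : ℝ) ^ (((i : ℤ) - 2) * n) ≤ (4 : ℝ) ^ (((j : ℤ) - 2) * n) := by
  apply zpow_le_zpow_right₀ (by norm_num)
  have : ((i : ℤ) - 2) ≤ ((j : ℤ) - 2) := by omega
  exact mul_le_mul_of_nonneg_right this (by positivity)

/-- `uPow` is nonnegative. -/
theorem uPow_nonneg' (k : ℕ) (U : ℝ) : 0 ≤ uPow k U := by
  unfold uPow; split_ifs <;> positivity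

/-- `uPow k U = U²` for `k ≠ 0`. -/
theorem uPow_of_ne_zero {k : ℕ} (hk : k ≠ 0) (U : ℝ) : uPow k U = U ^ 2 := by simp [uPow, hk]

/-- **Order comparison of the bars** (`1 ≤ i ≤ j`, nonnegative constants):
`curveJetBar c c' U i n ≤ (c i + c' i·|U|)·U²·4^{(j−2)n}`. -/
theorem curveJetBar_le_of_le (hc : ∀ k, 0 ≤ c k) (hc' : ∀ k, 0 ≤ c' k) {i j : ℕ} (hi : 1 ≤ i) (hij : i ≤ j) (U : ℝ) (n : ℕ) :
    curveJetBar c c' U i n ≤ (c i + c' i * |U|) * U ^ 2 * (4 : ℝ) ^ (((j : ℤ) - 2) * n) := by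
  rw [curveJetBar_apply, uPow_of_ne_zero (by omega)]
  have h1 : 0 ≤ (c i + c' i * |U|) * U ^ 2 := by have := hc i; have := hc' i; positivity
  exact mul_le_mul_of_nonneg_left (four_zpow_order_mono hij n) h1

/-- **The centred envelope from the jets** (`j ≥ 1`): for a `C⁴` `2π`-periodic `δ` with `|δ^{(k)}| ≤ curveJetBar c c' U k n` (`k ≤ 4`),
every centred derivative of order `i ≤ j ≤ 4` is within `(2π·(c 1 + c' 1|U|) + Σ_{1≤i≤j}(c i + c' i|U|))·U²·4^{(j−2)n}`. -/
theorem norm_iteratedFDeriv_centred_le_of_jets (hc : ∀ k, 0 ≤ c k) (hc' : ∀ k, 0 ≤ c' k) (hδ : ContDiff ℝ 4 δ)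
    (hper : Function.Periodic δ (2 * π)) (hjet : ∀ k ≤ 4, ∀ θ : ℝ, |iteratedDeriv k δ θ| ≤ curveJetBar c c' U k n)
    {j : ℕ} (hj1 : 1 ≤ j) (hj : j ≤ 4) {i : ℕ} (hi : i ≤ j) (t : ℝ) :
    ‖iteratedFDeriv ℝ i (fun t => δ t - klAngularMean δ) t‖ ≤
      (2 * π * (c 1 + c' 1 * |U|) + ∑ i ∈ Icc 1 j, (c i + c' i * |U|)) * U ^ 2 * (4 : ℝ) ^ (((j : ℤ) - 2) * n) := by
  have hdiff : Differentiable ℝ δ := hδ.differentiable (by norm_num)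
  set P : ℝ := U ^ 2 * (4 : ℝ) ^ (((j : ℤ) - 2) * n) with hP
  have hP0 : 0 ≤ P := by positivity
  have hterm_nn : ∀ i, 0 ≤ c i + c' i * |U| := fun i => by have := hc i; have := hc' i; positivity
  -- each order-`i` bar, `1 ≤ i ≤ j`, is within its summand times `P`
  have hbar : ∀ i, 1 ≤ i → i ≤ j → curveJetBar c c' U i n ≤ (c i + c' i * |U|) * P := by
    intro i hi1 hij
    have h := curveJetBar_le_of_le hc hc' hi1 hij U n
    rw [hP, ← mul_assoc]; exact h
  have hsum_ge : ∀ i, 1 ≤ i → i ≤ j → (c i + c' i * |U|) * P ≤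
      (2 * π * (c 1 + c' 1 * |U|) + ∑ i ∈ Icc 1 j, (c i + c' i * |U|)) * U ^ 2 * (4 : ℝ) ^ (((j : ℤ) - 2) * n) := by
    intro i hi1 hij
    rw [mul_assoc, ← hP]
    refine mul_le_mul_of_nonneg_right ?_ hP0
    have hmem : i ∈ Icc 1 j := by simp [hi1, hij]
    have h1 : (c i + c' i * |U|) ≤ ∑ i ∈ Icc 1 j, (c i + c' i * |U|) :=
      single_le_sum (f := fun i => c i + c' i * |U|) (fun k _ => hterm_nn k) hmem
    have h2 : 0 ≤ 2 * π * (c 1 + c' 1 * |U|) := by have := hterm_nn 1; positivity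
    linarith
  rw [norm_iteratedFDeriv_eq_norm_iteratedDeriv, Real.norm_eq_abs]
  rcases Nat.eq_zero_or_pos i with rfl | hipos
  · -- order 0: the centred value from the slope
    rw [iteratedDeriv_zero]
    have hslope : ∀ θ, |deriv δ θ| ≤ curveJetBar c c' U 1 n := fun θ => by
      have h := hjet 1 (by norm_num) θ
      rwa [iteratedDeriv_one] at h
    have h0 := abs_sub_klAngularMean_le_of_deriv hdiff hper hslope t
    have h1 : 2 * π * curveJetBar c c' U 1 n ≤ 2 * π * ((c 1 + c' 1 * |U|) * P) :=
      mul_le_mul_of_nonneg_left (hbar 1 le_rfl hj1) (by positivity)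
    have hs : 0 ≤ ∑ i ∈ Icc 1 j, (c i + c' i * |U|) := sum_nonneg fun k _ => hterm_nn k
    have h2 : 2 * π * ((c 1 + c' 1 * |U|) * P) ≤ (2 * π * (c 1 + c' 1 * |U|) + ∑ i ∈ Icc 1 j, (c i + c' i * |U|)) * P := by
      nlinarith [mul_nonneg hs hP0]
    have h3 : (2 * π * (c 1 + c' 1 * |U|) + ∑ i ∈ Icc 1 j, (c i + c' i * |U|)) * P =
        (2 * π * (c 1 + c' 1 * |U|) + ∑ i ∈ Icc 1 j, (c i + c' i * |U|)) * U ^ 2 * (4 : ℝ) ^ (((j : ℤ) - 2) * n) := by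
      rw [hP]; ring
    exact h0.trans (h1.trans (h2.trans_eq h3))
  · -- order `i ≥ 1`: the constant drops out
    have hsub : iteratedDeriv i (fun t => δ t - klAngularMean δ) = iteratedDeriv i δ := by
      obtain ⟨i', rfl⟩ : ∃ i', i = i' + 1 := ⟨i - 1, by omega⟩
      rw [iteratedDeriv_succ', iteratedDeriv_succ']
      congr 1
      funext s
      exact deriv_sub_const (f := δ) (klAngularMean δ)
    rw [hsub]
    exact ((hjet i (by omega) t).trans (hbar i hipos hi)).trans (hsum_ge i hipos hi)

/-- **GENERIC: sizes of a G-extension from curve jets.**  A `2π`-periodic `C⁴` profile `δ` with `|δ^{(k)}(θ)| ≤ curveJetBar c c' U k n`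
(`k ≤ 4`, nonnegative constants) has `‖Dʲ onM (klFrameExtFn μ δ) q‖ ≤ curveJetBar (curveExtC X c) (curveExtC X c') U j n` for every `j ≤ 4`
and every `q` (`μ ∈ klWindowC`, `X ≥ sup_{l ≤ 4} ‖Dˡχ₂‖`). -/
theorem norm_iteratedFDeriv_onM_klFrameExtFn_le_curveJetBar (hc : ∀ k, 0 ≤ c k) (hc' : ∀ k, 0 ≤ c' k) (hδ : ContDiff ℝ 4 δ)
    (hper : Function.Periodic δ (2 * π)) (hjet : ∀ k ≤ 4, ∀ θ : ℝ, |iteratedDeriv k δ θ| ≤ curveJetBar c c' U k n)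
    {μ : ℝ} (hμ : μ ∈ klWindowC) {X : ℝ} (hX : ∀ l ≤ 4, ∀ x : ℝ, ‖iteratedFDeriv ℝ l salmhoferCutoff x‖ ≤ X)
    {P : FrameFn} (hPdef : P = klFrameExtFn μ δ) {j : ℕ} (hj : j ≤ 4) (q : Momentum) :
    ‖iteratedFDeriv ℝ j (onM P) q‖ ≤ curveJetBar (curveExtC X c) (curveExtC X c') U j n := by
  have hX0 : 0 ≤ X := le_trans (norm_nonneg _) (hX 0 (by norm_num) 0)
  have hjN : ((j : ℕ) : WithTop ℕ∞) ≤ (4 : WithTop ℕ∞) := by exact_mod_cast hj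
  rcases Nat.eq_zero_or_pos j with rfl | hjpos
  · -- order 0: envelope `2·bar₀`, mean `≤ bar₀`
    have hb0 : ∀ θ, |δ θ| ≤ curveJetBar c c' U 0 n := fun θ => by simpa only [iteratedDeriv_zero] using hjet 0 (by norm_num) θ
    have hmean : |klAngularMean δ| ≤ curveJetBar c c' U 0 n := abs_klAngularMean_le' hb0
    have hG : ∀ i ≤ 0, ∀ t : ℝ, ‖iteratedFDeriv ℝ i (fun t => δ t - klAngularMean δ) t‖ ≤ 2 * curveJetBar c c' U 0 n := by
      intro i hi t
      rw [Nat.le_zero.mp hi, norm_iteratedFDeriv_zero, Real.norm_eq_abs]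
      calc |δ t - klAngularMean δ| ≤ |δ t| + |klAngularMean δ| := abs_sub _ _
        _ ≤ curveJetBar c c' U 0 n + curveJetBar c c' U 0 n := add_le_add (hb0 t) hmean
        _ = 2 * curveJetBar c c' U 0 n := by ring
    have h := norm_iteratedFDeriv_onM_piece_le hPdef hδ hper hjN hμ hG (fun l hl x => hX l (by omega) x) q
    refine h.trans ?_
    have hB0 : 0 ≤ curveJetBar c c' U 0 n := curveJetBar_nonneg hc hc' U 0 n
    have hrhs : curveJetBar (curveExtC X c) (curveExtC X c') U 0 n = (1 + 4 * X) * curveJetBar c c' U 0 n := by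
      rw [curveJetBar_apply, curveJetBar_apply, curveExtC_zero, curveExtC_zero]; ring
    rw [hrhs]
    simp only [if_true, Nat.factorial_zero, Nat.cast_one, one_pow, pow_zero, mul_one]
    nlinarith [hmean, mul_nonneg hX0 hB0]
  · -- order `j ≥ 1`: the centred envelope from the jets
    set Γ : ℝ := (2 * π * (c 1 + c' 1 * |U|) + ∑ i ∈ Icc 1 j, (c i + c' i * |U|)) * U ^ 2 * (4 : ℝ) ^ (((j : ℤ) - 2) * n) with hΓ
    have hG : ∀ i ≤ j, ∀ t : ℝ, ‖iteratedFDeriv ℝ i (fun t => δ t - klAngularMean δ) t‖ ≤ Γ := fun i hi t =>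
      norm_iteratedFDeriv_centred_le_of_jets hc hc' hδ hper hjet hjpos hj hi t
    have h := norm_iteratedFDeriv_onM_piece_le hPdef hδ hper hjN hμ hG (fun l hl x => hX l (by omega) x) q
    refine h.trans (le_of_eq ?_)
    have hjne : j ≠ 0 := by omega
    simp only [hjne, if_false, zero_add]
    rw [curveJetBar_apply, curveExtC_of_ne_zero X c hjne, curveExtC_of_ne_zero X c' hjne, uPow_of_ne_zero hjne, hΓ]
    have hsplit : ∑ i ∈ Icc 1 j, (c i + c' i * |U|) = ∑ i ∈ Icc 1 j, c i + (∑ i ∈ Icc 1 j, c' i) * |U| := by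
      rw [sum_add_distrib, sum_mul]
    rw [hsplit]
    ring

/-- **Smoothness** of the extension of a `C⁴` periodic profile (re-export of `contDiff_onM_piece` at order `4`). -/
theorem contDiff_four_onM_of_profile (hδ : ContDiff ℝ 4 δ) (hper : Function.Periodic δ (2 * π)) {μ : ℝ} (hμ : μ ∈ klWindowC)
    {P : FrameFn} (hPdef : P = klFrameExtFn μ δ) : ContDiff ℝ 4 (onM P) :=
  contDiff_onM_piece (N' := 4) hPdef (by exact_mod_cast hδ) hper hμ

end Generic

/-! ## §3 The sizes of `ℓ_n(K.eval)` from `TwoLegCurveJetBound … K n` -/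

section Piece

variable {L M : ℕ} [NeZero L] [NeZero M] {c c' : ℕ → ℝ} {β U μ : ℝ} {K : TrigPolyC4v}

/-- The curve profile at `n + 1` is `2π`-periodic (unconditionally). -/
theorem klTwoLegCurveProfile_succ_periodic (β U μ : ℝ) (K : TrigPolyC4v) (n : ℕ) :
    Function.Periodic (klTwoLegCurveProfile L M β U μ K (n + 1)) (2 * π) := fun θ => by
  simp only [klTwoLegCurveProfile_succ, klLocalPart_periodic β U μ K (n + 1) θ, klLocalPart_periodic β U μ K n θ]

/-- The curve profile at `0` is `2π`-periodic (unconditionally). -/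
theorem klTwoLegCurveProfile_zero_periodic (β U μ : ℝ) (K : TrigPolyC4v) :
    Function.Periodic (klTwoLegCurveProfile L M β U μ K 0) (2 * π) := fun θ => by
  simp only [klTwoLegCurveProfile_zero, klLocalPart_periodic β U μ K 0 θ, frameOnCurve_periodic μ K θ]

/-- The curve profile at every scale is `2π`-periodic. -/
theorem klTwoLegCurveProfile_periodic (β U μ : ℝ) (K : TrigPolyC4v) (n : ℕ) :
    Function.Periodic (klTwoLegCurveProfile L M β U μ K n) (2 * π) := by
  rcases n with _ | n
  · exact klTwoLegCurveProfile_zero_periodic β U μ K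
  · exact klTwoLegCurveProfile_succ_periodic β U μ K n

/-- **`ℓ_{n+1}(K.eval) = klFrameExtFn μ δ_{n+1}`** (continuity of the two local parts). -/
theorem klTwoLegPieceFn_eval_succ_eq_ext_profile (β U μ : ℝ) (K : TrigPolyC4v) (n : ℕ)
    (h₁ : Continuous (klLocalPart L M β U μ K (n + 1))) (h₀ : Continuous (klLocalPart L M β U μ K n)) :
    klTwoLegPieceFn L M β U μ K.eval (n + 1) = klFrameExtFn μ (klTwoLegCurveProfile L M β U μ K (n + 1)) := by
  rw [klTwoLegPieceFn_eval_succ β U μ K n h₁ h₀, klTwoLegCurveProfile_succ]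

/-- **`ℓ_0(K.eval) = klFrameExtFn μ δ_0`** (continuity of the scale-`0` local part and of `K∘k_F^K`). -/
theorem klTwoLegPieceFn_eval_zero_eq_ext_profile (β U μ : ℝ) (K : TrigPolyC4v) (h₀ : Continuous (klLocalPart L M β U μ K 0))
    (hK : Continuous fun θ => K.eval (klFermiPoint μ K θ)) :
    klTwoLegPieceFn L M β U μ K.eval 0 = klFrameExtFn μ (klTwoLegCurveProfile L M β U μ K 0) := by
  rw [klTwoLegPieceFn_eval_zero β U μ K h₀ hK, klTwoLegCurveProfile_zero]

/-- **Sizes of `ℓ_{n+1}(K.eval)` at every order `j ≤ 4` from the curve jets**: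
`‖Dʲ onM ℓ_{n+1} q‖ ≤ curveJetBar (curveExtC X c) (curveExtC X c') U j (n+1)`. -/
theorem norm_iteratedFDeriv_onM_klTwoLegPieceFn_eval_succ_le_of_curveJetBound (hc : ∀ k, 0 ≤ c k) (hc' : ∀ k, 0 ≤ c' k)
    (hμ : μ ∈ klWindowC) {n : ℕ} (h₁ : Continuous (klLocalPart L M β U μ K (n + 1))) (h₀ : Continuous (klLocalPart L M β U μ K n))
    (hjet : TwoLegCurveJetBound L M c c' β U μ K (n + 1)) {X : ℝ} (hX : ∀ l ≤ 4, ∀ x : ℝ, ‖iteratedFDeriv ℝ l salmhoferCutoff x‖ ≤ X)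
    {j : ℕ} (hj : j ≤ 4) (q : Momentum) :
    ‖iteratedFDeriv ℝ j (onM (klTwoLegPieceFn L M β U μ K.eval (n + 1))) q‖ ≤ curveJetBar (curveExtC X c) (curveExtC X c') U j (n + 1) :=
  norm_iteratedFDeriv_onM_klFrameExtFn_le_curveJetBar hc hc' hjet.1 (klTwoLegCurveProfile_succ_periodic β U μ K n) hjet.2 hμ hX
    (klTwoLegPieceFn_eval_succ_eq_ext_profile β U μ K n h₁ h₀) hj q

/-- **Sizes of `ℓ_0(K.eval)` at every order `j ≤ 4` from the curve jets.** -/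
theorem norm_iteratedFDeriv_onM_klTwoLegPieceFn_eval_zero_le_of_curveJetBound (hc : ∀ k, 0 ≤ c k) (hc' : ∀ k, 0 ≤ c' k)
    (hμ : μ ∈ klWindowC) (h₀ : Continuous (klLocalPart L M β U μ K 0)) (hK : Continuous fun θ => K.eval (klFermiPoint μ K θ))
    (hjet : TwoLegCurveJetBound L M c c' β U μ K 0) {X : ℝ} (hX : ∀ l ≤ 4, ∀ x : ℝ, ‖iteratedFDeriv ℝ l salmhoferCutoff x‖ ≤ X)
    {j : ℕ} (hj : j ≤ 4) (q : Momentum) :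
    ‖iteratedFDeriv ℝ j (onM (klTwoLegPieceFn L M β U μ K.eval 0)) q‖ ≤ curveJetBar (curveExtC X c) (curveExtC X c') U j 0 :=
  norm_iteratedFDeriv_onM_klFrameExtFn_le_curveJetBar hc hc' hjet.1 (klTwoLegCurveProfile_zero_periodic β U μ K) hjet.2 hμ hX
    (klTwoLegPieceFn_eval_zero_eq_ext_profile β U μ K h₀ hK) hj q

end Piece

/-! ## §4 The MS texts by the trivial split -/

section MS

variable {L M : ℕ} [NeZero L] [NeZero M] {G : GeoConsts} {Q : EngConsts} {R : RenConsts} {c c' : ℕ → ℝ} {β U μ : ℝ}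
  {K : TrigPolyC4v}

/-- The zero frame is a symmetric frame (local copy of …CountertermJacksonSelfMap's `isSymmetricFrame_zero`, to keep the imports light). -/
private theorem isSymmetricFrame_zero_fn : IsSymmetricFrame (0 : FrameFn) :=
  ⟨fun _ _ => rfl, fun _ => rfl, fun _ => rfl⟩

/-- **The trivial split** (generic): if `ℓ_n(K.eval)` is a symmetric frame, `C⁴` on `Momentum`, with `‖Dʲ onM ℓ_n‖ ≤ b j` (`j ≤ 4`), then
`TwoLegSizesMSWith L M β U μ K.eval n b (fun _ _ => 0)` with `lp n := ℓ_n(K.eval)`, `lp m := 0` (`m ≠ n`). -/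
theorem twoLegSizesMSWith_of_single {n : ℕ} {b : ℕ → ℝ} (hsym : IsSymmetricFrame (klTwoLegPieceFn L M β U μ K.eval n))
    (hcd : ContDiff ℝ 4 (onM (klTwoLegPieceFn L M β U μ K.eval n)))
    (hb : ∀ j ≤ 4, ∀ q : Momentum, ‖iteratedFDeriv ℝ j (onM (klTwoLegPieceFn L M β U μ K.eval n)) q‖ ≤ b j) :
    TwoLegSizesMSWith L M β U μ K.eval n b (fun _ _ => 0) := by
  classical
  refine ⟨fun m => if m = n then klTwoLegPieceFn L M β U μ K.eval n else 0, fun p => ?_, fun m => ?_, fun j hj q => ?_,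
    fun m hm j hj q => ?_⟩
  · have hzero : ∀ m ∈ Ioc n (nScales β), (if m = n then klTwoLegPieceFn L M β U μ K.eval n else (0 : FrameFn)) p = 0 := by
      intro m hm
      have hne : m ≠ n := by have := (mem_Ioc.mp hm).1; omega
      simp [hne]
    rw [sum_eq_zero hzero]; simp
  · by_cases hm : m = n
    · simp only [hm, if_true]; exact ⟨hsym, hcd⟩
    · simp only [hm, if_false]
      have h0 : onM (0 : FrameFn) = fun _ => (0 : ℝ) := by funext q; rfl
      exact ⟨isSymmetricFrame_zero_fn, by rw [h0]; exact contDiff_const⟩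
  · simp only [if_true]; exact hb j hj q
  · have hne : m ≠ n := by have := (mem_Ioc.mp hm).1; omega
    simp only [hne, if_false]
    have h0 : onM (0 : FrameFn) = fun _ => (0 : ℝ) := by funext q; rfl
    rw [h0, iteratedFDeriv_fun_zero]; simp

/-- **(E3a-MS), budget-parametric, AT `n + 1`, FROM THE CURVE JETS**: `TwoLegCurveJetBound … K (n+1)` gives
`TwoLegSizesMSWith L M β U μ K.eval (n+1) (fun j => curveJetBar (curveExtC X c) (curveExtC X c') U j (n+1)) (fun _ _ => 0)`. -/
theorem twoLegSizesMSWith_succ_of_curveJetBound (hc : ∀ k, 0 ≤ c k) (hc' : ∀ k, 0 ≤ c' k) (hμ : μ ∈ klWindowC) {n : ℕ}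
    (h₁ : Continuous (klLocalPart L M β U μ K (n + 1))) (h₀ : Continuous (klLocalPart L M β U μ K n))
    (hjet : TwoLegCurveJetBound L M c c' β U μ K (n + 1)) {X : ℝ} (hX : ∀ l ≤ 4, ∀ x : ℝ, ‖iteratedFDeriv ℝ l salmhoferCutoff x‖ ≤ X) :
    TwoLegSizesMSWith L M β U μ K.eval (n + 1) (fun j => curveJetBar (curveExtC X c) (curveExtC X c') U j (n + 1)) (fun _ _ => 0) :=
  twoLegSizesMSWith_of_single (isSymmetricFrame_klTwoLegPieceFn_eval_succ K n h₁ h₀ hμ)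
    (contDiff_four_onM_of_profile hjet.1 (klTwoLegCurveProfile_succ_periodic β U μ K n) hμ
      (klTwoLegPieceFn_eval_succ_eq_ext_profile β U μ K n h₁ h₀))
    (fun _ hj q => norm_iteratedFDeriv_onM_klTwoLegPieceFn_eval_succ_le_of_curveJetBound hc hc' hμ h₁ h₀ hjet hX hj q)

/-- **(E3a-MS), budget-parametric, AT `0`, FROM THE CURVE JETS.** -/
theorem twoLegSizesMSWith_zero_of_curveJetBound (hc : ∀ k, 0 ≤ c k) (hc' : ∀ k, 0 ≤ c' k) (hμ : μ ∈ klWindowC)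
    (h₀ : Continuous (klLocalPart L M β U μ K 0)) (hK : Continuous fun θ => K.eval (klFermiPoint μ K θ))
    (hjet : TwoLegCurveJetBound L M c c' β U μ K 0) {X : ℝ} (hX : ∀ l ≤ 4, ∀ x : ℝ, ‖iteratedFDeriv ℝ l salmhoferCutoff x‖ ≤ X) :
    TwoLegSizesMSWith L M β U μ K.eval 0 (fun j => curveJetBar (curveExtC X c) (curveExtC X c') U j 0) (fun _ _ => 0) :=
  twoLegSizesMSWith_of_single (isSymmetricFrame_klTwoLegPieceFn_eval_zero K h₀ hK hμ)
    (contDiff_four_onM_of_profile hjet.1 (klTwoLegCurveProfile_zero_periodic β U μ K) hμ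
      (klTwoLegPieceFn_eval_zero_eq_ext_profile β U μ K h₀ hK))
    (fun _ hj q => norm_iteratedFDeriv_onM_klTwoLegPieceFn_eval_zero_le_of_curveJetBound hc hc' hμ h₀ hK hjet hX hj q)

/-- The slot allowance of the V15/V16 text is nonnegative for nonnegative package fields. -/
theorem msBarQ_mul_pieceBar_nonneg (hCE : 0 ≤ Q.CE) (hS1 : 0 ≤ G.S 1) (hS'1 : 0 ≤ Q.S' 1) (hR : ∀ j, 0 ≤ R.Gfr j) (U : ℝ)
    (n m j : ℕ) : 0 ≤ msBarQ G Q U n * (R.Gfr j * uPow j U * (4 : ℝ) ^ (((j : ℤ) - 2) * m)) := by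
  have h1 : 0 ≤ twoLegBar G Q U 1 n := by
    unfold twoLegBar
    have := uPow_nonneg' 1 U
    have : 0 ≤ G.S 1 + Q.S' 1 * |U| := by positivity
    positivity
  have h2 : 0 ≤ msBarQ G Q U n := by unfold msBarQ; positivity
  have h3 := uPow_nonneg' j U
  have h4 := hR j
  positivity

/-- **The package FIT**: `curveExtC X c j ≤ G.S j` and `curveExtC X c' j ≤ Q.S' j` give `curveJetBar (curveExtC X c) (curveExtC X c') U j n ≤
twoLegBar G Q U j n`. -/
theorem curveJetBar_curveExtC_le_twoLegBar {X : ℝ} {j : ℕ} (hfit : curveExtC X c j ≤ G.S j) (hfit' : curveExtC X c' j ≤ Q.S' j)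
    (U : ℝ) (n : ℕ) : curveJetBar (curveExtC X c) (curveExtC X c') U j n ≤ twoLegBar G Q U j n := by
  rw [← curveJetBar_eq_twoLegBar]
  unfold curveJetBar
  have h2 := uPow_nonneg' j U
  have h3 : (0 : ℝ) ≤ (4 : ℝ) ^ (((j : ℤ) - 2) * n) := zpow_nonneg (by norm_num) _
  have h1 : curveExtC X c j + curveExtC X c' j * |U| ≤ G.S j + Q.S' j * |U| :=
    add_le_add hfit (mul_le_mul_of_nonneg_right hfit' (abs_nonneg U))
  exact mul_le_mul_of_nonneg_right (mul_le_mul_of_nonneg_right h1 h2) h3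

/-- **(E3a-MS-TQ) AT SCALE `n + 1` FROM STUB 6's CURVE JETS — the trivial split, TEN package inequalities.**  Under
`TwoLegCurveJetBound L M c c' β U μ K (n+1)`, continuity of the two local parts, `X ≥ sup_{l≤4}‖Dˡχ₂‖`, the fit `curveExtC X c j ≤ G.S j`,
`curveExtC X c' j ≤ Q.S' j` (`j ≤ 4`) and the signs of `Q.CE, G.S 1, Q.S' 1, R.Gfr`: `TwoLegSizesMSTQ L M G Q R β U μ K (n+1)`.  No symbol
decomposition, no `σ/ε` profiles, no `Λ₃/Λ₄`, no MS fits. -/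
theorem twoLegSizesMSTQ_succ_of_curveJetBound (hc : ∀ k, 0 ≤ c k) (hc' : ∀ k, 0 ≤ c' k) (hμ : μ ∈ klWindowC) {n : ℕ}
    (h₁ : Continuous (klLocalPart L M β U μ K (n + 1))) (h₀ : Continuous (klLocalPart L M β U μ K n))
    (hjet : TwoLegCurveJetBound L M c c' β U μ K (n + 1)) {X : ℝ} (hX : ∀ l ≤ 4, ∀ x : ℝ, ‖iteratedFDeriv ℝ l salmhoferCutoff x‖ ≤ X)
    (hfit : ∀ j ≤ 4, curveExtC X c j ≤ G.S j) (hfit' : ∀ j ≤ 4, curveExtC X c' j ≤ Q.S' j)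
    (hCE : 0 ≤ Q.CE) (hS1 : 0 ≤ G.S 1) (hS'1 : 0 ≤ Q.S' 1) (hR : ∀ j, 0 ≤ R.Gfr j) :
    TwoLegSizesMSTQ L M G Q R β U μ K (n + 1) :=
  (twoLegSizesMSWith_succ_of_curveJetBound hc hc' hμ h₁ h₀ hjet hX).toMSTQ
    (fun j hj => curveJetBar_curveExtC_le_twoLegBar (hfit j hj) (hfit' j hj) U (n + 1))
    (fun m _ j _ => msBarQ_mul_pieceBar_nonneg hCE hS1 hS'1 hR U (n + 1) m j)

/-- **(E3a-MS-TQ) AT SCALE `0` FROM STUB 6's CURVE JETS — the trivial split, TEN package inequalities.** -/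
theorem twoLegSizesMSTQ_zero_of_curveJetBound (hc : ∀ k, 0 ≤ c k) (hc' : ∀ k, 0 ≤ c' k) (hμ : μ ∈ klWindowC)
    (h₀ : Continuous (klLocalPart L M β U μ K 0)) (hK : Continuous fun θ => K.eval (klFermiPoint μ K θ))
    (hjet : TwoLegCurveJetBound L M c c' β U μ K 0) {X : ℝ} (hX : ∀ l ≤ 4, ∀ x : ℝ, ‖iteratedFDeriv ℝ l salmhoferCutoff x‖ ≤ X)
    (hfit : ∀ j ≤ 4, curveExtC X c j ≤ G.S j) (hfit' : ∀ j ≤ 4, curveExtC X c' j ≤ Q.S' j)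
    (hCE : 0 ≤ Q.CE) (hS1 : 0 ≤ G.S 1) (hS'1 : 0 ≤ Q.S' 1) (hR : ∀ j, 0 ≤ R.Gfr j) :
    TwoLegSizesMSTQ L M G Q R β U μ K 0 :=
  (twoLegSizesMSWith_zero_of_curveJetBound hc hc' hμ h₀ hK hjet hX).toMSTQ
    (fun j hj => curveJetBar_curveExtC_le_twoLegBar (hfit j hj) (hfit' j hj) U 0)
    (fun m _ j _ => msBarQ_mul_pieceBar_nonneg hCE hS1 hS'1 hR U 0 m j)

/-- **The package instance**: with the jets already at the package fields (`TwoLegCurveJetBoundGQ`, bars `twoLegBar G Q U k n`) the fit reads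
`curveExtC X G.S j ≤ G'.S j`, `curveExtC X Q.S' j ≤ Q'.S' j` for the TARGET package `(G', Q')` — recorded as the `n + 1` corollary for a pair of
packages (the registrant's raise `(G, Q) ↦ (G', Q')`). -/
theorem twoLegSizesMSTQ_succ_of_curveJetBoundGQ {G' : GeoConsts} {Q' : EngConsts} (hS : ∀ k, 0 ≤ G.S k) (hS' : ∀ k, 0 ≤ Q.S' k)
    (hμ : μ ∈ klWindowC) {n : ℕ} (h₁ : Continuous (klLocalPart L M β U μ K (n + 1))) (h₀ : Continuous (klLocalPart L M β U μ K n))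
    (hjet : TwoLegCurveJetBoundGQ L M G Q β U μ K (n + 1)) {X : ℝ} (hX : ∀ l ≤ 4, ∀ x : ℝ, ‖iteratedFDeriv ℝ l salmhoferCutoff x‖ ≤ X)
    (hfit : ∀ j ≤ 4, curveExtC X G.S j ≤ G'.S j) (hfit' : ∀ j ≤ 4, curveExtC X Q.S' j ≤ Q'.S' j)
    (hCE : 0 ≤ Q'.CE) (hS1 : 0 ≤ G'.S 1) (hS'1 : 0 ≤ Q'.S' 1) (hR : ∀ j, 0 ≤ R.Gfr j) :
    TwoLegSizesMSTQ L M G' Q' R β U μ K (n + 1) :=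
  twoLegSizesMSTQ_succ_of_curveJetBound hS hS' hμ h₁ h₀ hjet hX hfit hfit' hCE hS1 hS'1 hR

end MS

end Summit.HubbardSuperconductivity.HubbardSuperconductivity.Theorems.KLRegimeSplit

end
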